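import Summits.CriticalPhenomena.CardyFormulaZ2.Theorems.CardySelfRefinementDefs
import Summits.CriticalPhenomena.CardyFormulaZ2.Theorems.CardySelfRefinementTrivialSectorRateStubSixArmDecayReduction
import Summits.CriticalPhenomena.CardyFormulaZ2.Theorems.CardySelfRefinementTrivialSectorRateStubSixArmDecayClusters
import Summits.CriticalPhenomena.CardyFormulaZ2.Theorems.CardySelfRefinementLagHandOffSixArmOfFiveArmWinding
import Summits.CriticalPhenomena.CardyFormulaZ2.Theorems.CardySelfRefinementLagHandOffSixArmOfFiveArmCircuits
import Literature.Probability.Percolation.ZdFourArmFromFiveArm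
import Literature.Probability.Percolation.ZdFiveArmDuality
import Literature.Probability.Percolation.BondPercolationSymmetry
import Literature.Probability.Percolation.InequalitiesProofs
import Literature.Probability.Percolation.SelfRefinementMeasure
import HarnessLib

/-!
# Stub `stub_sixArm_of_fiveArm` (K3 reduction) of line `hitting-tournament`
(crux stmt-CriticalPhenomena-10268): SIX ARMS ABOVE TWO FROM THE FIVE-ARM UPPER BOUND

K3 of the crux's kernel package is the whole-plane alternating six-arm bound with exponent `2 + ε`
for critical bond percolation on `ℤ²`, in the cluster form `FarField.sixArmThreeClustersAt c m n`
(`Theorems/CardySelfRefinementDefs.lean`: three open crossings of `c + A_{m,n}`, pairwise NOT joined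
by an open path of `c + A_{m,n}`).  This file REDUCES it to the classical two-radii five-arm upper
bound `P_{1/2}(ω - c ∈ zdFiveArmClusters m n) ≤ C₅ (m/n)²` (`m₀ ≤ m ≤ n`; hypothesis `h₅`, the
form consumed by `sixArmDecayAlong_of_fiveArm`): `stub_sixArm_of_fiveArm`.

The price of the sixth arm is paid through Reimer's inequality (`reimer_holds`), exactly as the
tree's `𝒜₅ ⊆ 𝒜₄ □ 𝒜₁` (`zdFiveArmClusters_subset_disjointOccurrence`), with a decreasing event in
the rôle of the dual arm:

* `sixArmOfFiveArm_subset_disjointOccurrence` — **`𝒜₆ ⊆ 𝒜₅ □ 𝒟`** on lattice configurations,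
  where `𝒟` = "no open closed walk of non-zero winding about `[0,1]²` in any of the sub-annuli
  `A_{aᵢ,bᵢ} ⊆ A_{m,n}`".  Witnesses: with `𝒞₃` the open cluster in `A_{m,n}` of the third inner
  endpoint `x₃`, `K` = the open edges together with ALL pairs having an endpoint in `𝒞₃`, and
  `L = Kᶜ` (closed pairs off `𝒞₃`).  On `[ω]_K` the three crossings stay open and `x₃` stays cut
  off from `x₁` (every pair at a vertex of `𝒞₃` keeps its state), which is the five-arm event with
  `x₃, x₁` separated and the second crossing as the free third arm; on `[ω]_L` every open closed walk
  of the annulus uses only edges that are open in `ω` or touch `𝒞₃`, hence has winding `0` by the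
  planar lemma `sixArmOfFiveArm_walkWinding_eq_zero` (file `…SixArmOfFiveArmWinding`).  The sixth,
  DISJOINT witness is exactly what upgrades the exponent from `2` to `2 + ε`;
* `sixArmOfFiveArm_real_le_mul` — Reimer: `P(𝒜₆(0,m,n)) ≤ P(𝒜₅(m,n)) · P(𝒟)` (both events are
  local);
* `sixArmOfFiveArm_sixthArm` — with the RSW decay `P(𝒟) ≤ c (m/n)^a` over `≍ log (n/m)` geometric
  annuli (`sixArmOfFiveArm_real_noWindingCircuits_le_rpow`, file `…SixArmOfFiveArmCircuits`) and
  translation invariance (`sixArmThreeClustersAt_eq_preimage`, `bondPercolation_real_preimage_shift`):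
  `P(𝒜₆(c,m,n)) ≤ c (m/n)^a · P(ω - c ∈ 𝒜₅(m,n))` for all centres `c` and `2 ≤ m ≤ n`;
* `stub_sixArm_of_fiveArm` — the bookkeeping `sixArmDecayAlong_of_fiveArm` (file
  `…TrivialSectorRateStubSixArmDecayReduction`, valid for every `k` and every parameter path) run on
  the constant path at the critical point `(ρ,c) = (0, ½)`, where `M_k(0,½) = P_{1/2}`
  (`selfRefinementMeasure_zero_half`): exponent `2 + a`, uniformly in the centre and all `1 ≤ m ≤ n`.

References: D. Reimer, Combin. Probab. Comput. 9 (2000); P. Nolin, Electron. J. Probab. 13 (2008),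
§4–5 and proof of Cor. 36; H. Kesten, Comm. Math. Phys. 109 (1987); G. Grimmett, *Percolation*
(1999), §11.7.
-/

noncomputable section

open Set SimpleGraph MeasureTheory
open Literature.Probability.Percolation Literature.Probability.LatticeModels
open Summit.CriticalPhenomena.CardyFormulaZ2.Theorems.CardySelfRefinement
open Summit.CriticalPhenomena.CardyFormulaZ2.Theorems.CardySelfRefinement.FarField

namespace Summit.CriticalPhenomena.CardyFormulaZ2.Cruxes.LagHandOff.HittingTournament

/-! ### The cut around the third cluster survives on the cylinder `[ω]_K` -/

/-- **Agreement at the cluster of `x₃` preserves its isolation.**  If `ω'` agrees with `ω` on every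
pair having an endpoint joined to `x₃` inside `S` (in `ω`), then whatever `x₃` reaches inside `S`
in `ω'` it already reaches in `ω` (a step of `ω'` out of the `ω`-cluster of `x₃` is a pair at a
cluster vertex, hence open in `ω`). -/
theorem sixArmOfFiveArm_openConnIn_of_agree {V : Type*} {S : Set V} {ω ω' : BondConfig V} {x₃ : V}
    (hK : ∀ e : Sym2 V, (∃ v ∈ e, ω ∈ openConnIn S x₃ v) → (e ∈ ω' ↔ e ∈ ω)) {v : V}
    (h : ω' ∈ openConnIn S x₃ v) : ω ∈ openConnIn S x₃ v := by
  obtain ⟨hx, hv, ⟨p⟩⟩ := h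
  suffices key : ∀ (a b : S) (q : ((openGraph ω').induce S).Walk a b),
      ω ∈ openConnIn S x₃ a.1 → ω ∈ openConnIn S x₃ b.1 from
    key ⟨x₃, hx⟩ ⟨v, hv⟩ p (openConnIn_refl hx)
  intro a b q
  induction q with
  | nil => exact id
  | @cons a a' b hadj q ih =>
    intro ha
    simp only [SimpleGraph.comap_adj, Function.Embedding.coe_subtype, openGraph_adj] at hadj
    have he : s(a.1, a'.1) ∈ ω := (hK _ ⟨a.1, Sym2.mem_mk_left _ _, ha⟩).1 hadj.1
    exact ih (PlanarDuality.openConnIn_trans ha (openConnIn_of_adj a.2 a'.2 he hadj.2))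

/-! ### `𝒜₆ ⊆ 𝒜₅ □ 𝒟` -/

/-- **Six arms are the disjoint occurrence of five arms and of "no open winding circuit"** (lattice
configurations, around the origin, `1 ≤ m`).  For sub-annuli `A_{aᵢ,bᵢ} ⊆ A_{m,n}` (`i ∈ s`):
`sixArmThreeClustersAt 0 m n ⊆ zdFiveArmClusters m n □ ⋂ᵢ {no open closed walk of A_{aᵢ,bᵢ} with
non-zero winding about [0,1]²}`.  Witnesses `K = ω ∪ {pairs at the cluster of x₃}`, `L = Kᶜ`; see the
module docstring. -/
theorem sixArmOfFiveArm_subset_disjointOccurrence {m n : ℕ} (hm : 1 ≤ m) (s : Finset ℕ)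
    (a b : ℕ → ℕ) (hab : ∀ i ∈ s, m ≤ a i ∧ b i ≤ n) {ω : BondConfig (Site 2)}
    (hω : ω ⊆ (zdGraph 2).edgeSet) (h6 : ω ∈ sixArmThreeClustersAt 0 m n) :
    ω ∈ zdFiveArmClusters m n □ ⋂ i ∈ s,
      {ω : BondConfig (Site 2) | ∃ (u : Site 2) (C : (zdGraph 2).Walk u u),
        (∀ z ∈ C.support, z ∈ sqAnnulus (a i) (b i)) ∧ (∀ e ∈ C.edges, e ∈ ω) ∧
          walkWinding C 0 ≠ 0}ᶜ := by
  classical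
  rw [mem_sixArmThreeClustersAt_zero_iff] at h6
  obtain ⟨x, y, hxy, hpair⟩ := h6
  set S : Set (Site 2) := sqAnnulus m n with hS
  obtain ⟨W₀, hs₀, he₀⟩ := exists_walk_of_mem_openConnIn hω (hxy 0).2.2
  obtain ⟨W₁, hs₁, he₁⟩ := exists_walk_of_mem_openConnIn hω (hxy 1).2.2
  obtain ⟨W₂, hs₂, he₂⟩ := exists_walk_of_mem_openConnIn hω (hxy 2).2.2
  have h01 : ω ∉ openConnIn S (x 0) (x 1) := hpair (show (0 : Fin 3) ≠ 1 by decide)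
  have h20 : ω ∉ openConnIn S (x 2) (x 0) := hpair (show (2 : Fin 3) ≠ 0 by decide)
  have h21 : ω ∉ openConnIn S (x 2) (x 1) := hpair (show (2 : Fin 3) ≠ 1 by decide)
  -- two walks of distinct clusters share no edge
  have hdisj : ∀ {i j : Fin 3} (Wi : (zdGraph 2).Walk (x i) (y i)) (Wj : (zdGraph 2).Walk (x j) (y j)),
      ω ∉ openConnIn S (x i) (x j) → (∀ z ∈ Wi.support, z ∈ S) → (∀ e ∈ Wi.edges, e ∈ ω) →
      (∀ z ∈ Wj.support, z ∈ S) → (∀ e ∈ Wj.edges, e ∈ ω) →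
      ∀ e ∈ Wi.edges, e ∉ Wj.edges := by
    intro i j Wi Wj hij hsi hei hsj hej e hi hj
    induction e using Sym2.ind with
    | h p q =>
      have h1 : ω ∈ openConnIn S (x i) p :=
        mem_openConnIn_of_mem_support Wi hsi hei (Wi.fst_mem_support_of_mem_edges hi)
      have h2 : ω ∈ openConnIn S (x j) p :=
        mem_openConnIn_of_mem_support Wj hsj hej (Wj.fst_mem_support_of_mem_edges hj)
      rw [openConnIn_comm] at h2
      exact hij (PlanarDuality.openConnIn_trans h1 h2)
  -- the witnesses
  set K : Set (Sym2 (Site 2)) := {e | e ∈ ω ∨ ∃ v ∈ e, ω ∈ openConnIn S (x 2) v} with hK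
  refine ⟨K, Kᶜ, disjoint_compl_right, ?_, ?_⟩
  · -- `[ω]_K ⊆ 𝒜₅`: crossings of `x₂` (cut off) and `x₀`, third arm the crossing of `x₁`
    intro ω' hω'
    have hop : ∀ e ∈ ω, e ∈ ω' := fun e he => (hω' e (Or.inl he)).2 he
    refine ⟨x 2, x 0, x 1, y 2, y 0, y 1, W₂, W₀, W₁, (hxy 2).1, (hxy 0).1, (hxy 1).1, (hxy 2).2.1,
      (hxy 0).2.1, (hxy 1).2.1, hs₂, hs₀, hs₁, fun e he => hop e (he₂ e he),
      fun e he => hop e (he₀ e he), fun e he => hop e (he₁ e he),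
      hdisj W₂ W₁ h21 hs₂ he₂ hs₁ he₁, hdisj W₀ W₁ h01 hs₀ he₀ hs₁ he₁, fun hc => h20 ?_⟩
    exact sixArmOfFiveArm_openConnIn_of_agree (fun e he => hω' e (Or.inr he)) hc
  · -- `[ω]_L ⊆ 𝒟`: open closed walks of `ω'` use edges open in `ω` or at the cluster of `x₂`
    intro ω' hω'
    refine Set.mem_iInter₂.2 fun i hi => ?_
    rintro ⟨u, C, hCs, hCe, hCW⟩
    obtain ⟨hai, hbi⟩ := hab i hi
    refine hCW (sixArmOfFiveArm_walkWinding_eq_zero hm hω (hxy 0).1 (hxy 0).2.1 (hxy 1).1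
      (hxy 1).2.1 (hxy 0).2.2 (hxy 1).2.2 h01 h20 h21 C
      (fun z hz => sqAnnulus_mono hai hbi (hCs z hz)) fun e he => ?_)
    by_contra hne
    exact hne (Or.inl ((hω' e hne).1 (hCe e he)))

/-! ### Locality of `𝒟` and Reimer's inequality -/

/-- **`𝒟` is determined by the pairs of sites of `A_{m,n}`** for the geometric sub-annuli
`A_{4ⁱm, 2·4ⁱm}`, `i < J`, inside `A_{m,n}`. -/
theorem sixArmOfFiveArm_determinedBy_noWindingCircuits (m n J : ℕ)
    (hJ : ∀ i < J, 2 * (4 ^ i * m) ≤ n) :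
    DeterminedBy (⋂ i ∈ Finset.range J,
      {ω : BondConfig (Site 2) | ∃ (u : Site 2) (C : (zdGraph 2).Walk u u),
        (∀ z ∈ C.support, z ∈ sqAnnulus (4 ^ i * m) (2 * (4 ^ i * m))) ∧
          (∀ e ∈ C.edges, e ∈ ω) ∧ walkWinding C 0 ≠ 0}ᶜ) ↑((annulus 2 (m - 1) n).sym2) := by
  classical
  set F : Set (Sym2 (Site 2)) := ↑((annulus 2 (m - 1) n).sym2) with hF
  have hpow : ∀ i : ℕ, m ≤ 4 ^ i * m := fun i =>
    Nat.le_mul_of_pos_left m (Nat.one_le_pow _ _ (by norm_num))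
  have hsub : ∀ i < J,
      (↑((annulus 2 (4 ^ i * m - 1) (2 * (4 ^ i * m))).sym2) : Set (Sym2 (Site 2))) ⊆ F := by
    intro i hi
    rw [hF, Finset.coe_subset]
    refine Finset.sym2_mono fun v hv => ?_
    rw [mem_annulus] at hv ⊢
    have h1 := hJ i hi
    have h2 := hpow i
    exact ⟨box_mono 2 h1 hv.1, fun h => hv.2 (box_mono 2 (by omega) h)⟩
  suffices key : ∀ ω ω' : BondConfig (Site 2), ω ∩ F = ω' ∩ F →
      ω ∈ (⋂ i ∈ Finset.range J,
        {ω : BondConfig (Site 2) | ∃ (u : Site 2) (C : (zdGraph 2).Walk u u),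
          (∀ z ∈ C.support, z ∈ sqAnnulus (4 ^ i * m) (2 * (4 ^ i * m))) ∧
            (∀ e ∈ C.edges, e ∈ ω) ∧ walkWinding C 0 ≠ 0}ᶜ) →
      ω' ∈ (⋂ i ∈ Finset.range J,
        {ω : BondConfig (Site 2) | ∃ (u : Site 2) (C : (zdGraph 2).Walk u u),
          (∀ z ∈ C.support, z ∈ sqAnnulus (4 ^ i * m) (2 * (4 ^ i * m))) ∧
            (∀ e ∈ C.edges, e ∈ ω) ∧ walkWinding C 0 ≠ 0}ᶜ) by
    rw [determinedBy_iff]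
    exact fun ω ω' h => ⟨key ω ω' h, key ω' ω h.symm⟩
  intro ω ω' h hω
  refine Set.mem_iInter₂.2 fun i hi => ?_
  have hi' : i < J := Finset.mem_range.1 hi
  have hωi := Set.mem_iInter₂.1 hω i hi
  have hagree : ω ∩ ↑((annulus 2 (4 ^ i * m - 1) (2 * (4 ^ i * m))).sym2) =
      ω' ∩ ↑((annulus 2 (4 ^ i * m - 1) (2 * (4 ^ i * m))).sym2) := by
    rw [← Set.inter_eq_self_of_subset_right (hsub i hi'), ← Set.inter_assoc, h, Set.inter_assoc]
  rw [Set.mem_compl_iff] at hωi ⊢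
  rwa [← (determinedBy_iff _ _).1 (sixArmOfFiveArm_determinedBy_windingCircuit _ _) ω ω' hagree]

/-- **Reimer: `P_{1/2}(𝒜₆(0,m,n)) ≤ P_{1/2}(𝒜₅(m,n)) · P_{1/2}(𝒟)`** for the geometric sub-annuli
`A_{4ⁱm, 2·4ⁱm} ⊆ A_{m,n}`, `i < J` (`𝒜₆ ⊆ 𝒜₅ □ 𝒟` almost surely, both events local,
`reimer_holds`). -/
theorem sixArmOfFiveArm_real_le_mul {m n : ℕ} (hm : 1 ≤ m) (J : ℕ)
    (hJ : ∀ i < J, 2 * (4 ^ i * m) ≤ n) :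
    (bondPercolation (zdGraph 2) half).real (sixArmThreeClustersAt 0 m n) ≤
      (bondPercolation (zdGraph 2) half).real (zdFiveArmClusters m n) *
        (bondPercolation (zdGraph 2) half).real (⋂ i ∈ Finset.range J,
          {ω : BondConfig (Site 2) | ∃ (u : Site 2) (C : (zdGraph 2).Walk u u),
            (∀ z ∈ C.support, z ∈ sqAnnulus (4 ^ i * m) (2 * (4 ^ i * m))) ∧
              (∀ e ∈ C.edges, e ∈ ω) ∧ walkWinding C 0 ≠ 0}ᶜ) := by
  set P := bondPercolation (zdGraph 2) half with hP
  have hpow : ∀ i : ℕ, m ≤ 4 ^ i * m := fun i =>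
    Nat.le_mul_of_pos_left m (Nat.one_le_pow _ _ (by norm_num))
  have hae : sixArmThreeClustersAt 0 m n ≤ᵐ[P] zdFiveArmClusters m n □ ⋂ i ∈ Finset.range J,
      {ω : BondConfig (Site 2) | ∃ (u : Site 2) (C : (zdGraph 2).Walk u u),
        (∀ z ∈ C.support, z ∈ sqAnnulus (4 ^ i * m) (2 * (4 ^ i * m))) ∧
          (∀ e ∈ C.edges, e ∈ ω) ∧ walkWinding C 0 ≠ 0}ᶜ :=
    (ae_subset_edgeSet (zdGraph 2) half).mono fun ω hω h6 =>
      sixArmOfFiveArm_subset_disjointOccurrence hm (Finset.range J) (fun i => 4 ^ i * m)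
        (fun i => 2 * (4 ^ i * m)) (fun i hi => ⟨hpow i, hJ i (Finset.mem_range.1 hi)⟩) hω h6
  refine (ENNReal.toReal_mono (measure_ne_top _ _) (measure_mono_ae hae)).trans ?_
  exact reimer_holds (zdGraph 2) half ⟨_, determinedBy_zdFiveArmClusters m n⟩
    ⟨_, sixArmOfFiveArm_determinedBy_noWindingCircuits m n J hJ⟩

/-! ### The price of the sixth arm -/

/-- **The sixth arm costs `(m/n)^a` given five** (critical bond-`ℤ²`, every centre): there are
`a, C₆ > 0` with `P_{1/2}(sixArmThreeClustersAt c m n) ≤ C₆ (m/n)^a · P_{1/2}(ω - c ∈ zdFiveArmClusters m n)`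
for all `c` and `2 ≤ m ≤ n` (translate to the origin, Reimer, RSW decay of `𝒟`). -/
theorem sixArmOfFiveArm_sixthArm : ∃ δ C₆ : ℝ, 0 < δ ∧ ∃ m₀ : ℕ, ∀ (c : Site 2) (m n : ℕ),
    m₀ ≤ m → m ≤ n →
      (bondPercolation (zdGraph 2) half).real (sixArmThreeClustersAt c m n) ≤
        C₆ * ((m : ℝ) / n) ^ δ * (bondPercolation (zdGraph 2) half).real
          (BondConfig.relabel (sym2Equiv (Site.shift (-c))) ⁻¹' zdFiveArmClusters m n) := by
  obtain ⟨c₀, a, hc₀, ha, hdec⟩ := sixArmOfFiveArm_real_noWindingCircuits_le_rpow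
  refine ⟨a, c₀, ha, 2, fun c m n hm hmn => ?_⟩
  rw [sixArmThreeClustersAt_eq_preimage, bondPercolation_real_preimage_shift,
    bondPercolation_real_preimage_shift]
  obtain ⟨J, hJ, hPJ⟩ := hdec m n hm hmn
  have h5 : 0 ≤ (bondPercolation (zdGraph 2) half).real (zdFiveArmClusters m n) := measureReal_nonneg
  calc (bondPercolation (zdGraph 2) half).real (sixArmThreeClustersAt 0 m n)
      ≤ (bondPercolation (zdGraph 2) half).real (zdFiveArmClusters m n) *
        (bondPercolation (zdGraph 2) half).real (⋂ i ∈ Finset.range J,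
          {ω : BondConfig (Site 2) | ∃ (u : Site 2) (C : (zdGraph 2).Walk u u),
            (∀ z ∈ C.support, z ∈ sqAnnulus (4 ^ i * m) (2 * (4 ^ i * m))) ∧
              (∀ e ∈ C.edges, e ∈ ω) ∧ walkWinding C 0 ≠ 0}ᶜ) :=
        sixArmOfFiveArm_real_le_mul (by omega) J hJ
    _ ≤ (bondPercolation (zdGraph 2) half).real (zdFiveArmClusters m n) * (c₀ * ((m : ℝ) / n) ^ a) :=
        mul_le_mul_of_nonneg_left hPJ h5
    _ = c₀ * ((m : ℝ) / n) ^ a * (bondPercolation (zdGraph 2) half).real (zdFiveArmClusters m n) := by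
        ring

/-! ### The registered stub -/

/-- **K3 reduction: six arms above two from the five-arm upper bound** (registered stub
`stub_sixArm_of_fiveArm` of line `hitting-tournament`).  If critical bond percolation on `ℤ²`
satisfies the two-radii five-arm upper bound `P_{1/2}(ω - c ∈ zdFiveArmClusters m n) ≤ C₅ (m/n)²`
for `m₀ ≤ m ≤ n` (every centre `c`; by translation invariance the centre is immaterial), then the
alternating six-arm event in cluster form decays with exponent `2 + ε`, uniformly in the centre:
`P_{1/2}(sixArmThreeClustersAt c m n) ≤ C (m/n)^{2+ε}` for all `c` and `1 ≤ m ≤ n`.  Proof: the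
sixth-arm price `sixArmOfFiveArm_sixthArm` (Reimer + RSW) and the bookkeeping
`sixArmDecayAlong_of_fiveArm` on the constant parameter path at `M_k(0,½) = P_{1/2}`. -/
theorem stub_sixArm_of_fiveArm : (∃ C₅ : ℝ, ∃ m₀ : ℕ, ∀ (c : Site 2) (m n : ℕ), m₀ ≤ m → m ≤ n →
    (bondPercolation (zdGraph 2) half).real
      (BondConfig.relabel (sym2Equiv (Site.shift (-c))) ⁻¹' zdFiveArmClusters m n) ≤
        C₅ * ((m : ℝ) / n) ^ 2) →
    ∃ ε : ℝ, 0 < ε ∧ ∃ C : ℝ, ∀ (c : Site 2) (m n : ℕ), 1 ≤ m → m ≤ n →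
      (bondPercolation (zdGraph 2) half).real
        (Summit.CriticalPhenomena.CardyFormulaZ2.Theorems.CardySelfRefinement.FarField.sixArmThreeClustersAt
          c m n) ≤ C * ((m : ℝ) / n) ^ (2 + ε) := by
  rintro ⟨C₅, m₅, h₅⟩
  -- the constant parameter path at the critical point `(ρ, c) = (0, ½)`
  have hM : ∀ s : unitInterval, M 1 ((fun _ : unitInterval => ((0 : ℝ), (1 / 2 : ℝ))) s).1
      ((fun _ : unitInterval => ((0 : ℝ), (1 / 2 : ℝ))) s).2 = bondPercolation (zdGraph 2) half :=
    fun _ => selfRefinementMeasure_zero_half 1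
  obtain ⟨δ, C₆, hδ, m₆, h₆⟩ := sixArmOfFiveArm_sixthArm
  have h := sixArmDecayAlong_of_fiveArm 1 (fun _ : unitInterval => ((0 : ℝ), (1 / 2 : ℝ)))
    ⟨C₅, m₅, fun s c m n hm hmn => by rw [hM s]; exact h₅ c m n hm hmn⟩
    ⟨δ, C₆, hδ, m₆, fun s c m n hm hmn => by rw [hM s]; exact h₆ c m n hm hmn⟩
  obtain ⟨ε, C, hε, h⟩ := h
  refine ⟨ε, hε, C, fun c m n hm hmn => ?_⟩
  have := h 0 c m n hm hmn
  rwa [hM 0] at this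

end Summit.CriticalPhenomena.CardyFormulaZ2.Cruxes.LagHandOff.HittingTournament

end
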